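import Literature.NumberTheory.Rogawski1990.LocalTransfer
import Literature.NumberTheory.Automorphic.UnitaryGroupFormTransport
import Literature.AlgebraicGeometry.ShimuraVarieties.UnitaryOrthogonalFrame
import Literature.NumberTheory.NumberFields.CMFieldGeneratedByUnitaryElement
import HarnessLib

/-!
# K2 · E4 · U1 #20 helper — a rational `G`-REGULAR MATCHING PAIR `γ_H → γ` for an anisotropic hermitian `H′`

Helper file for `Theorems/K2E4WeakMatrixAlmostEverywhereAgreement.lean` (socket `sig_K2E4WeakMatrixAlmostEverywhereAgreement` of
`Cruxes/H413/Lines/K2_E4_SingularTransferKappaSignSigsWeakMatrixRigidity.lean`, crux H413 = `stmt-HodgeConjecture-24833`, cell `pub/hodgecm-mathlib`,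
Track B «K2-LIT», base K2E4-p20).  THEOREMS ONLY (no `def`, no instance, no notation, no `sorry`).

WHAT.  For `H′ ∈ M₃(L)` hermitian and anisotropic over the CM field `L` there are a `G`-regular rational `γ_H ∈ H(L⁺) = U(Φ₂)(L⁺) × U(Φ₁)(L⁺)` and a rational
`γ ∈ U(H′)(L⁺)` with `γ_H → γ` (★ `IsNormPair`): take `ζ ∈ L¹ ∖ {±1}` (★ `IsCMField.setOf_mul_complexConj_eq_one_infinite`), an `H′`-orthogonal frame `b`
(★ `exists_orthogonalFrame`) and put `γ = b·diag(1, −1, ζ)·b⁻¹`, `γ_H = (P·diag(1, ζ)·P⁻¹, (−1))` with `P = (1 1; 1 −1)` (which `Φ₂`-orthogonalises `L²`);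
both `ι(γ_H)` and `γ` are `GL₃(L)`-conjugate to `diag(1, −1, ζ)`, whose characteristic polynomial is separable.  This is the «rational regular pair» at which
the product formula ∕ almost-everywhere triviality of a weak transfer-factor datum can be READ (Rogawski 1990, §4.3 p. 44: «`Δ_{G_v∕H_v}(γ_H, γ̄_v) = 1` for
almost all `v`» is a statement about such pairs).

* `diagonal_mem_unitaryGroupOfForm` — a diagonal matrix with `σ(dᵢ)dᵢ = 1` is unitary for every form with vanishing off-diagonal entries;
* `separable_charpoly_diagonal_of_injective` — `charpoly (diag d)` is separable for `d` injective (over a field);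
* **`exists_isGRegular_isNormPair`** — the pair.

HONEST LABEL: HC_CM is proved only modulo the 7 printed citations (2 remaining named inputs: hLiu418 = stmt-HodgeConjecture-24832,
h413 = stmt-HodgeConjecture-24833) until rung 0 closes; this file is elementary linear algebra and consumes nothing printed.
-/

set_option autoImplicit false
set_option linter.dupNamespace false

noncomputable section

open Matrix NumberField Polynomial
open Literature.NumberTheory.Rogawski1990 Literature.NumberTheory.Automorphic
open Literature.AlgebraicGeometry.ShimuraVarieties (unitaryGroup mem_unitaryGroup_iff hermForm)
open scoped Matrix MatrixGroups

namespace Summit.HodgeConjecture.HodgeConjecture.Cruxes.H413.K2E4WeakMatrixAlmostEverywhereAgreement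

section Generic

variable {R : Type*} [CommRing R] {n : Type*} [Fintype n] [DecidableEq n] (σ : R →+* R)

/-- **A diagonal matrix `diag(d)` with `σ(dᵢ)·dᵢ = 1` lies in `U(σ, D)` for every form `D` with vanishing off-diagonal entries**
(`σ(diag d)ᵀ D diag d = D` entrywise). [cite: Rogawski1990, §3.1 p. 19] -/
theorem diagonal_mem_unitaryGroupOfForm {D : Matrix n n R} (hD : ∀ i j, i ≠ j → D i j = 0) (d : n → R)
    (hd : ∀ i, σ (d i) * d i = 1) (u : GL n R) (hu : (u : Matrix n n R) = Matrix.diagonal d) :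
    u ∈ unitaryGroupOfForm σ D := by
  rw [mem_unitaryGroupOfForm_iff, hu, Matrix.diagonal_map (map_zero σ), Matrix.diagonal_transpose]
  ext i j
  rw [Matrix.mul_diagonal, Matrix.diagonal_mul]
  by_cases hij : i = j
  · subst hij
    calc σ (d i) * D i i * d i = (σ (d i) * d i) * D i i := by ring
      _ = D i i := by rw [hd i, one_mul]
  · rw [hD i j hij, mul_zero, zero_mul]

end Generic

section Field

variable {K : Type*} [Field K] {n : Type*} [Fintype n] [DecidableEq n]

/-- `charpoly (diag d) = ∏ᵢ (X − C dᵢ)`. [cite: Rogawski1990, §3.1 p. 19] -/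
theorem charpoly_diagonal' (d : n → K) : (Matrix.diagonal d).charpoly = ∏ i, (X - C (d i)) := by
  rw [Matrix.charpoly, show (Matrix.diagonal d).charmatrix = Matrix.diagonal fun i => X - C (d i) from ?_, Matrix.det_diagonal]
  ext i j
  by_cases hij : i = j
  · subst hij
    rw [Matrix.charmatrix_apply_eq, Matrix.diagonal_apply_eq, Matrix.diagonal_apply_eq]
  · rw [Matrix.charmatrix_apply_ne _ _ _ hij, Matrix.diagonal_apply_ne _ hij, Matrix.diagonal_apply_ne _ hij, map_zero, neg_zero]

/-- **`charpoly (diag d)` is separable when the `dᵢ` are pairwise distinct** (a regular semisimple diagonal element). [cite: Rogawski1990, §3.1 p. 19] -/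
theorem separable_charpoly_diagonal_of_injective (d : n → K) (hd : Function.Injective d) :
    (Matrix.diagonal d).charpoly.Separable := by
  rw [charpoly_diagonal']
  exact (Polynomial.separable_prod_X_sub_C_iff (f := d)).2 hd

/-- `(1 : K) ≠ -1` in characteristic `0`. [folklore] -/
theorem one_ne_neg_one' (K' : Type*) [Field K'] [CharZero K'] : (1 : K') ≠ -1 := fun h =>
  two_ne_zero (α := K') (by linear_combination h)

end Field

section CM

variable (L : Type) [Field L] [NumberField L] [IsCMField L]

/-- **A norm-one element of `L` other than `±1`**: the set `{ζ | ζ·ζ̄ = 1}` is infinite (★ `IsCMField.setOf_mul_complexConj_eq_one_infinite`).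
[cite: Huybrechts2016K3, Ch. 3 §3.5 (PDF pp. 71–72)] -/
theorem exists_normOne_ne_one_ne_neg_one : ∃ ζ : L, cmConjRingHom L ζ * ζ = 1 ∧ ζ ≠ 1 ∧ ζ ≠ -1 := by
  classical
  obtain ⟨ζ, hζ, hζn⟩ := (Literature.NumberTheory.NumberFields.IsCMField.setOf_mul_complexConj_eq_one_infinite (K := L)).exists_notMem_finset
    ({1, -1} : Finset L)
  refine ⟨ζ, ?_, fun h => hζn (by simp [h]), fun h => hζn (by simp [h])⟩
  rw [cmConjRingHom_apply, mul_comm]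
  exact hζ

/-- **A RATIONAL `G`-REGULAR MATCHING PAIR `γ_H → γ`** for `H′ ∈ M₃(L)` hermitian and anisotropic: some `G`-regular `γ_H ∈ H(L⁺) = U(Φ₂)(L⁺) × U(Φ₁)(L⁺)`
(★ `IsGRegular`) matches (★ `IsNormPair`: `ι(γ_H)` and `γ` conjugate in `GL₃(L)`) some rational `γ ∈ U(H′)(L⁺)`.  Witness: `ζ ∈ L¹ ∖ {±1}`, an
`H′`-orthogonal frame `b` (★ `exists_orthogonalFrame`), `γ = b·diag(1, −1, ζ)·b⁻¹`, `γ_H = (P·diag(1, ζ)·P⁻¹, (−1))` with `P = (1 1; 1 −1)`.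
[cite: Rogawski1990, §4.3 pp. 42–44; §4.9 p. 54] -/
theorem exists_isGRegular_isNormPair (H' : Matrix (Fin 3) (Fin 3) L) (hherm : (H'.map (cmConjRingHom L))ᵀ = H')
    (hanis : ∀ x : Fin 3 → L, hermForm (cmConjRingHom L) H' x x = 0 → x = 0) :
    ∃ (γH : (UnitaryGroup.cmDatum L 2 (Matrix.of fun i j : Fin 2 => if i.val + j.val + 1 = 2 then (1 : L) else 0)).Rational ×
        (UnitaryGroup.cmDatum L 1 (Matrix.of fun i j : Fin 1 => if i.val + j.val + 1 = 1 then (1 : L) else 0)).Rational)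
      (γ : (UnitaryGroup.cmDatum L 3 H').Rational),
      IsGRegular (cmConjRingHom L) (Matrix.of fun i j : Fin 2 => if i.val + j.val + 1 = 2 then (1 : L) else 0)
          (Matrix.of fun i j : Fin 1 => if i.val + j.val + 1 = 1 then (1 : L) else 0)
          (Matrix.of fun i j : Fin 3 => if i.val + j.val + 1 = 3 then (1 : L) else 0) endoForm_antidiagOne γH ∧
        IsNormPair L H' γH γ := by
  classical
  obtain ⟨ζ, hζ, hζ1, hζ2⟩ := exists_normOne_ne_one_ne_neg_one L
  have hζ0 : ζ ≠ 0 := fun h => by rw [h, mul_zero] at hζ; exact zero_ne_one hζ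
  have h11 : (1 : L) ≠ -1 := one_ne_neg_one' L
  -- (1) the diagonal datum `d = (1, −1, ζ)`
  set d : Fin 3 → L := ![1, -1, ζ] with hd_def
  have hd : ∀ i, cmConjRingHom L (d i) * d i = 1 := by
    intro i
    fin_cases i
    · simp [hd_def]
    · simp [hd_def]
    · simpa [hd_def] using hζ
  have hdinj : Function.Injective d := by
    intro i j hij
    fin_cases i <;> fin_cases j <;> simp [hd_def] at hij ⊢
    all_goals first | exact absurd hij h11 | exact absurd hij.symm h11 | exact absurd hij.symm hζ1 | exact absurd hij hζ1 | exact absurd hij.symm hζ2 | exact absurd hij hζ2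
  have hdet3 : (Matrix.diagonal d).det ≠ 0 := by
    rw [Matrix.det_diagonal]
    simp [hd_def, Fin.prod_univ_three, hζ0]
  obtain ⟨Z, hZ⟩ : ∃ Z : GL (Fin 3) L, (Z : Matrix (Fin 3) (Fin 3) L) = Matrix.diagonal d :=
    ⟨Matrix.GeneralLinearGroup.mkOfDetNeZero (Matrix.diagonal d) hdet3, rfl⟩
  -- (2) an `H′`-orthogonal frame `b`, `γ = b Z b⁻¹ ∈ U(H′)(L⁺)`
  have hH : ∀ i j, cmConjRingHom L (H' i j) = H' j i := by
    intro i j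
    have h := congrFun (congrFun hherm j) i
    rwa [Matrix.transpose_apply, Matrix.map_apply] at h
  obtain ⟨b, -, hb⟩ := Literature.AlgebraicGeometry.ShimuraVarieties.UnitaryCanonicalModel.exists_orthogonalFrame H' hH hanis
    (Pi.single 0 1) (Function.ne_iff.2 ⟨0, by simp⟩)
  have hD : ∀ k l : Fin 3, k ≠ l → formCongr (cmConjRingHom L) b H' k l = 0 := by
    intro k l hkl
    rw [formCongr, Literature.AlgebraicGeometry.ShimuraVarieties.UnitaryCanonicalModel.transpose_map_mul_mul_apply]
    exact hb k l hkl
  have hZmem : Z ∈ unitaryGroupOfForm (cmConjRingHom L) (formCongr (cmConjRingHom L) b H') :=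
    diagonal_mem_unitaryGroupOfForm (cmConjRingHom L) hD d hd Z hZ
  have hγmem : b * Z * b⁻¹ ∈ unitaryGroup (cmConjRingHom L) H' :=
    mem_unitaryGroup_iff.2 (mem_unitaryGroupOfForm_iff.1 ((conj_mem_unitaryGroupOfForm_iff (cmConjRingHom L) b H' Z).2 hZmem))
  -- (3) the endoscopic side: `h₁ = (−1)`, `h₂ = P diag(1, ζ) P⁻¹`
  have hdet1 : (Matrix.diagonal (fun _ : Fin 1 => (-1 : L))).det ≠ 0 := by
    rw [Matrix.det_diagonal]; simp
  obtain ⟨h₁, hh₁⟩ : ∃ h₁ : GL (Fin 1) L, (h₁ : Matrix (Fin 1) (Fin 1) L) = Matrix.diagonal (fun _ : Fin 1 => (-1 : L)) :=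
    ⟨Matrix.GeneralLinearGroup.mkOfDetNeZero _ hdet1, rfl⟩
  have hh₁mem : h₁ ∈ unitaryGroup (cmConjRingHom L) (Matrix.of fun i j : Fin 1 => if i.val + j.val + 1 = 1 then (1 : L) else 0) :=
    mem_unitaryGroup_iff.2 (mem_unitaryGroupOfForm_iff.1 (diagonal_mem_unitaryGroupOfForm (cmConjRingHom L)
      (fun i j hij => absurd (Subsingleton.elim i j) hij) _ (fun _ => by simp) h₁ hh₁))
  set d₂ : Fin 2 → L := ![1, ζ] with hd₂_def
  have hdet2 : (Matrix.diagonal d₂).det ≠ 0 := by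
    rw [Matrix.det_diagonal]; simp [hd₂_def, Fin.prod_univ_two, hζ0]
  obtain ⟨D₂, hD₂⟩ : ∃ D₂ : GL (Fin 2) L, (D₂ : Matrix (Fin 2) (Fin 2) L) = Matrix.diagonal d₂ :=
    ⟨Matrix.GeneralLinearGroup.mkOfDetNeZero _ hdet2, rfl⟩
  have hdetP : (!![(1 : L), 1; 1, -1]).det ≠ 0 := by
    rw [Matrix.det_fin_two_of]
    intro h
    exact two_ne_zero (α := L) (by linear_combination -h)
  obtain ⟨P, hP⟩ : ∃ P : GL (Fin 2) L, (P : Matrix (Fin 2) (Fin 2) L) = !![(1 : L), 1; 1, -1] :=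
    ⟨Matrix.GeneralLinearGroup.mkOfDetNeZero _ hdetP, rfl⟩
  have hDP : ∀ k l : Fin 2, k ≠ l →
      formCongr (cmConjRingHom L) P (Matrix.of fun i j : Fin 2 => if i.val + j.val + 1 = 2 then (1 : L) else 0) k l = 0 := by
    intro k l hkl
    fin_cases k <;> fin_cases l
    all_goals first | exact absurd rfl hkl | skip
    all_goals simp [formCongr, hP, Matrix.mul_apply, Fin.sum_univ_two, Matrix.of_apply, Matrix.transpose_apply, Matrix.map_apply]
  have hD₂mem : D₂ ∈ unitaryGroupOfForm (cmConjRingHom L)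
      (formCongr (cmConjRingHom L) P (Matrix.of fun i j : Fin 2 => if i.val + j.val + 1 = 2 then (1 : L) else 0)) :=
    diagonal_mem_unitaryGroupOfForm (cmConjRingHom L) hDP d₂ (fun i => by fin_cases i <;> simp [hd₂_def, hζ]) D₂ hD₂
  have hh₂mem : P * D₂ * P⁻¹ ∈ unitaryGroup (cmConjRingHom L) (Matrix.of fun i j : Fin 2 => if i.val + j.val + 1 = 2 then (1 : L) else 0) :=
    mem_unitaryGroup_iff.2 (mem_unitaryGroupOfForm_iff.1 ((conj_mem_unitaryGroupOfForm_iff (cmConjRingHom L) P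
      (Matrix.of fun i j : Fin 2 => if i.val + j.val + 1 = 2 then (1 : L) else 0) D₂).2 hD₂mem))
  -- (4) `ι(D₂, h₁) = Z` in `GL₃(L)`
  have hE : endoGL (D₂, h₁) = Z := by
    refine Units.ext ?_
    rw [coe_endoGL_eq, hZ, hD₂, hh₁]
    ext i j
    fin_cases i <;> fin_cases j <;> simp [hd_def, hd₂_def, Matrix.diagonal]
  have hPone : (1 : GL (Fin 1) L) * h₁ * 1⁻¹ = h₁ := by group
  have hι : endoGL (P * D₂ * P⁻¹, h₁) = endoGL (P, 1) * Z * (endoGL (P, 1))⁻¹ := by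
    rw [← hE, ← map_mul, ← map_inv, ← map_mul, Prod.inv_mk, Prod.mk_mul_mk, Prod.mk_mul_mk, hPone]
  -- (5) assemble
  refine ⟨(⟨P * D₂ * P⁻¹, hh₂mem⟩, ⟨h₁, hh₁mem⟩), ⟨b * Z * b⁻¹, hγmem⟩, ?_, ?_⟩
  · -- `G`-regularity: `ι(γ_H) = Q Z Q⁻¹` with `charpoly Z = ∏ (X − dᵢ)` separable
    change IsRegularElt (endoGL (P * D₂ * P⁻¹, h₁))
    rw [hι, isRegularElt_conj_iff, isRegularElt_iff, hZ]
    exact separable_charpoly_diagonal_of_injective d hdinj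
  · -- matching: both sides are `GL₃(L)`-conjugate to `Z`
    rw [isNormPair_iff_isConj, coe_endoEmbRational]
    show IsConj (endoGL (P * D₂ * P⁻¹, h₁)) (b * Z * b⁻¹)
    rw [hι]
    refine isConj_iff.2 ⟨b * (endoGL (P, 1))⁻¹, ?_⟩
    group

end CM

end Summit.HodgeConjecture.HodgeConjecture.Cruxes.H413.K2E4WeakMatrixAlmostEverywhereAgreement

end
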